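import Summits.Ventures.HodgeRepro2.T5Multiplicity
import Summits.Ventures.HodgeRepro2.T5AveragedProjection

/-!
# Isotypic components: the sum of all copies of an irreducible, and the projections of a decomposition

Blind cell `pub-hodge-repro2`, seat p1 (gen 12), Tier-5 kernel support for the «isotypic / K-type
decomposition» sentence of `route/T5-SUPPORT-p1.md` §S4.7 (rows P2′/P3 of the N4.3 coverage map).

For a representation `π` on a finite-dimensional `V` and a representation `σ`, the **`σ`-isotypic
component** `isotypic π σ` is the sum of all irreducible stable subspaces `W ⊆ V` on which `π` restricts
to a representation equivalent to `σ` («copies of `σ`», `IsCopyOf π σ W`).  This file proves the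
structural facts that make the phrase «isotypic decomposition» precise:

* the projections `proj hint W` of an internal direct sum `V = ⨁_{W ∈ S} W` onto its summands
  (Mathlib `DirectSum.IsInternal.chooseDecomposition` / `DirectSum.decompose`), with
  `proj_apply_of_mem_same`, `proj_apply_of_mem_ne`, `sum_proj`, and — when every summand is stable —
  **`proj_comm`** (the projections intertwine `π`);
* **`le_sup_copies`** (Schur): a copy of `σ` lies in the sum of the copies of `σ` among the summands
  of ANY irreducible decomposition `S` (its projection to a summand not equivalent to `σ` is an
  intertwiner between inequivalent irreducibles, hence `0` —
  `T5SchurMathlib.eq_zero_of_isEmpty_equiv`);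
* **`isotypic_eq_sup_copies`**: `isotypic π σ = (S.filter (IsCopyOf π σ)).sup id` for every irreducible
  internal-direct-sum decomposition `S` — the isotypic component does not depend on the decomposition;
* `isStable_isotypic` (a supremum of stable subspaces is stable).

Related, not imported (twin check on the bus): p8's `T5Isotypic` / `T5IsotypicCopy` / `T5IsotypicHom` …
work with Mathlib's `isotypicComponent` of a semisimple MODULE over a group algebra (simple submodules,
Lemma N3.L8); this file works with the cell's `π : G →* (V →L[ℂ] V)`, its `IsIrreducibleSubspace` /
`restrictRep`, and `Finset` decompositions `DirectSum.IsInternal (fam S)` — the objects of the Schur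
group of gen 11–12.

Honest scope (unchanged from the Schur group): finite-dimensional representations only; nothing about
U(1,1), π₃⁺ or (N) — the K-types of π₃⁺ live in an infinite-dimensional representation.
-/

namespace Summit.Ventures.HodgeRepro2.T5IsotypicCopies

open T5SchurOrthogonality T5CompleteReducibility T5RestrictionRep T5SchurMathlib

variable {G : Type*} [Group G]
variable {V : Type*} [NormedAddCommGroup V] [InnerProductSpace ℂ V]
variable (π : G →* V →L[ℂ] V)

section copies

variable {W₀ : Type*} [NormedAddCommGroup W₀] [InnerProductSpace ℂ W₀]
variable (σ : G →* W₀ →L[ℂ] W₀)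

/-- `W` is a **copy of `σ`** in `π`: an irreducible stable subspace on which `π` restricts to a
representation equivalent to `σ` (Mathlib `Representation.Equiv` on `toRep`). -/
def IsCopyOf (W : Submodule ℂ V) : Prop :=
  ∃ h : IsIrreducibleSubspace π W, Nonempty ((toRep σ).Equiv (toRep (restrictRep π W h.2.1)))

/-- The **`σ`-isotypic component** of `π`: the sum of all copies of `σ`. -/
noncomputable def isotypic : Submodule ℂ V :=
  ⨆ W : {W : Submodule ℂ V // IsCopyOf π σ W}, (W : Submodule ℂ V)

/-- A copy of `σ` lies in the isotypic component. -/
theorem le_isotypic_of_isCopyOf {W : Submodule ℂ V} (hW : IsCopyOf π σ W) : W ≤ isotypic π σ :=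
  le_iSup (fun W : {W : Submodule ℂ V // IsCopyOf π σ W} => (W : Submodule ℂ V)) ⟨W, hW⟩

/-- The supremum of a family of stable subspaces is stable. -/
theorem isStable_iSup {ι : Sort*} (N : ι → Submodule ℂ V) (hN : ∀ i, IsStable π (N i)) :
    IsStable π (⨆ i, N i) := by
  intro g x hx
  exact Submodule.iSup_induction N (motive := fun x => π g x ∈ ⨆ i, N i) hx
    (fun i x hxi => Submodule.mem_iSup_of_mem i (hN i g x hxi)) (by simp)
    (fun x y hx hy => by rw [map_add]; exact Submodule.add_mem _ hx hy)

/-- The isotypic component is stable. -/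
theorem isStable_isotypic : IsStable π (isotypic π σ) :=
  isStable_iSup π _ fun W => W.2.1.2.1

open Classical in
/-- The sum of the copies of `σ` among the summands of a decomposition `S` lies in the isotypic
component. -/
theorem sup_copies_le_isotypic (S : Finset (Submodule ℂ V)) :
    (S.filter (IsCopyOf π σ)).sup id ≤ isotypic π σ :=
  Finset.sup_le fun _ hW => le_isotypic_of_isCopyOf π σ (Finset.mem_filter.mp hW).2

end copies

section proj

open DirectSum

variable (S : Finset (Submodule ℂ V))

/-- The family of summands of `S`, indexed by `S` itself. -/
abbrev fam (S : Finset (Submodule ℂ V)) : S → Submodule ℂ V := fun W => (W : Submodule ℂ V)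

variable (hint : DirectSum.IsInternal (fam S))

/-- The projection of the internal direct sum `V = ⨁_{W ∈ S} W` onto the summand `W`, as a linear
map `V →ₗ[ℂ] V` (the chosen `DirectSum.Decomposition` of `hint`, composed with the `W`-component and
the inclusion of `W`). -/
noncomputable def proj (W : S) : V →ₗ[ℂ] V :=
  letI := hint.chooseDecomposition
  (W : Submodule ℂ V).subtype ∘ₗ DirectSum.component ℂ S (fun W : S => ↥(fam S W)) W ∘ₗ
    (DirectSum.decomposeLinearEquiv (fam S)).toLinearMap

/-- `proj hint W x` is the `W`-component of the decomposition of `x`. -/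
theorem proj_apply (W : S) (x : V) :
    proj S hint W x =
      letI := hint.chooseDecomposition
      ((DirectSum.decompose (fam S) x) W : V) := rfl

/-- The projection onto `W` takes values in `W`. -/
theorem proj_apply_mem (W : S) (x : V) : proj S hint W x ∈ (W : Submodule ℂ V) := by
  rw [proj_apply]
  exact Subtype.mem _

/-- The projection onto `W` fixes `W`. -/
theorem proj_apply_of_mem_same (W : S) {x : V} (hx : x ∈ (W : Submodule ℂ V)) :
    proj S hint W x = x := by
  rw [proj_apply]
  letI := hint.chooseDecomposition
  exact DirectSum.decompose_of_mem_same (fam S) (i := W) hx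

/-- The projection onto `W` kills every other summand `W'`. -/
theorem proj_apply_of_mem_ne {W W' : S} {x : V} (hx : x ∈ (W' : Submodule ℂ V)) (h : W' ≠ W) :
    proj S hint W x = 0 := by
  rw [proj_apply]
  letI := hint.chooseDecomposition
  exact DirectSum.decompose_of_mem_ne (fam S) (i := W') (j := W) hx h

/-- The projections sum to the identity: `x = ∑_{W ∈ S} proj W x`. -/
theorem sum_proj (x : V) : ∑ W : S, proj S hint W x = x := by
  letI := hint.chooseDecomposition
  have h := DirectSum.sum_univ_of (DirectSum.decompose (fam S) x)
  have h2 := congrArg (DirectSum.decompose (fam S)).symm h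
  rw [Equiv.symm_apply_apply, DirectSum.decompose_symm_sum] at h2
  simp only [DirectSum.decompose_symm_of] at h2
  simpa only [proj_apply] using h2

/-- When every summand is `π`-stable, the projections intertwine `π`: `proj W (π g x) = π g (proj W x)`
(uniqueness of the decomposition of `π g x = ∑ π g (proj W x)`). -/
theorem proj_comm (hst : ∀ W ∈ S, IsStable π W) (W : S) (g : G) (x : V) :
    proj S hint W (π g x) = π g (proj S hint W x) := by
  classical
  conv_lhs => rw [← sum_proj S hint x, map_sum, map_sum]
  rw [Finset.sum_eq_single W]
  · exact proj_apply_of_mem_same S hint W (hst W W.2 g _ (proj_apply_mem S hint W x))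
  · intro W' _ hW'
    exact proj_apply_of_mem_ne S hint (hst W' W'.2 g _ (proj_apply_mem S hint W' x)) hW'
  · intro h
    exact absurd (Finset.mem_univ W) h

end proj

section schur

open DirectSum

variable [FiniteDimensional ℂ V]
variable {W₀ : Type*} [NormedAddCommGroup W₀] [InnerProductSpace ℂ W₀]
variable (σ : G →* W₀ →L[ℂ] W₀)
variable (S : Finset (Submodule ℂ V))

/-- The projection of an internal decomposition onto a summand `W`, restricted to a stable subspace
`W'` and viewed as a continuous linear map `W' →L[ℂ] W` (finite dimension). -/
noncomputable def projCLM (hint : DirectSum.IsInternal (fam S)) (W : S) (W' : Submodule ℂ V) :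
    W' →L[ℂ] (W : Submodule ℂ V) :=
  LinearMap.toContinuousLinearMap
    ((proj S hint W).restrict fun x _ => proj_apply_mem S hint W x)

/-- `projCLM` is the projection on elements. -/
theorem coe_projCLM_apply (hint : DirectSum.IsInternal (fam S)) (W : S) (W' : Submodule ℂ V)
    (x : W') : (projCLM S hint W W' x : V) = proj S hint W x := rfl

/-- `projCLM` intertwines the restricted representations when the summands and `W'` are stable. -/
theorem projCLM_comm (hint : DirectSum.IsInternal (fam S)) (hst : ∀ W ∈ S, IsStable π W) (W : S)
    {W' : Submodule ℂ V} (hW' : IsStable π W') (g : G) :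
    restrictRep π W (hst W W.2) g ∘L projCLM S hint W W' =
      projCLM S hint W W' ∘L restrictRep π W' hW' g := by
  ext x
  simp only [ContinuousLinearMap.comp_apply, coe_restrictRep_apply, coe_projCLM_apply]
  exact (proj_comm π S hint hst W g x).symm

/-- **Schur**: the projection of a copy `W'` of `σ` onto a summand `W` of an irreducible decomposition
that is NOT a copy of `σ` vanishes on `W'`. -/
theorem proj_apply_eq_zero_of_not_isCopyOf (hint : DirectSum.IsInternal (fam S))
    (hS : ∀ W ∈ S, IsIrreducibleSubspace π W) (W : S) (hW : ¬ IsCopyOf π σ W)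
    {W' : Submodule ℂ V} (hW' : IsCopyOf π σ W') {x : V} (hx : x ∈ W') :
    proj S hint W x = 0 := by
  obtain ⟨hW'irr, ⟨e⟩⟩ := hW'
  have hst : ∀ W ∈ S, IsStable π W := fun W hW => (hS W hW).2.1
  haveI : Nontrivial (W : Submodule ℂ V) := nontrivial_of_isIrreducibleSubspace π W (hS W W.2)
  haveI : Nontrivial W' := nontrivial_of_isIrreducibleSubspace π W' hW'irr
  haveI : (toRep (restrictRep π W (hst W W.2))).IsIrreducible :=
    (isIrreducible_iff _).mp (isIrreducible_restrictRep π W (hS W W.2) _)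
  haveI : (toRep (restrictRep π W' hW'irr.2.1)).IsIrreducible :=
    (isIrreducible_iff _).mp (isIrreducible_restrictRep π W' hW'irr _)
  haveI : IsEmpty ((toRep (restrictRep π W' hW'irr.2.1)).Equiv
      (toRep (restrictRep π W (hst W W.2)))) := by
    refine ⟨fun e' => hW ⟨hS W W.2, ⟨e.trans e'⟩⟩⟩
  have hzero := eq_zero_of_isEmpty_equiv (restrictRep π W (hst W W.2))
    (restrictRep π W' hW'irr.2.1) (projCLM S hint W W') (projCLM_comm π S hint hst W hW'irr.2.1)
  have := congrArg (fun T : W' →L[ℂ] (W : Submodule ℂ V) => (T ⟨x, hx⟩ : V)) hzero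
  simpa only [coe_projCLM_apply, _root_.zero_apply, Submodule.coe_zero] using this

open Classical in
/-- **A copy of `σ` lies in the sum of the copies of `σ` among the summands of any irreducible
decomposition**: `x = ∑_W proj W x` and the projections to the non-copies vanish. -/
theorem le_sup_copies (hint : DirectSum.IsInternal (fam S))
    (hS : ∀ W ∈ S, IsIrreducibleSubspace π W) {W' : Submodule ℂ V} (hW' : IsCopyOf π σ W') :
    W' ≤ (S.filter (IsCopyOf π σ)).sup id := by
  classical
  intro x hx
  rw [← sum_proj S hint x]
  refine Submodule.sum_mem _ fun W _ => ?_
  by_cases hW : IsCopyOf π σ W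
  · exact Finset.le_sup (f := id) (Finset.mem_filter.mpr ⟨W.2, hW⟩) (proj_apply_mem S hint W x)
  · rw [proj_apply_eq_zero_of_not_isCopyOf π σ S hint hS W hW hW' hx]
    exact Submodule.zero_mem _

open Classical in
/-- **The isotypic component is the sum of the copies in any irreducible decomposition**:
`isotypic π σ = (S.filter (IsCopyOf π σ)).sup id` for every irreducible internal-direct-sum
decomposition `S` of `V`. -/
theorem isotypic_eq_sup_copies (hint : DirectSum.IsInternal (fam S))
    (hS : ∀ W ∈ S, IsIrreducibleSubspace π W) :
    isotypic π σ = (S.filter (IsCopyOf π σ)).sup id :=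
  le_antisymm (iSup_le fun W => le_sup_copies π σ S hint hS W.2) (sup_copies_le_isotypic π σ S)

end schur

end Summit.Ventures.HodgeRepro2.T5IsotypicCopies
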